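import Summits.QuantumFields.BalabanUV.Beta.D1BFx.ProjectorWeightUnfold

/-!
# `BalabanUV.Beta.D1BFx.ResolventWeightUnfold` — road «BF-x» for binder row D1, slot (K), row **(K8-L)(d2) «LOCALISATION BY AUXILIARY FIELDS»** (owner FINDING
# F-g8-3): THE SECOND GAUSSIAN UN-FOLDING AT THE DETERMINANT LEVEL — a RESOLVENT `X⁻¹` sitting inside the coupling columns of a bordered system is removed by two
# auxiliary index blocks `(φ, ψ)` with the bordered constraint block `fromBlocks (c•1) X X 0`:
#   `det (fromBlocks A [E|F] [E|F]ᵀ (fromBlocks (c•1) X X 0)) = (−1)^{|σ|} · det(X)² · det (A − F·X⁻¹·Eᵀ − E·X⁻¹·Fᵀ + c•F·X⁻¹·X⁻¹·Fᵀ)`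
# (any square `A`, any `E F : α × σ`, invertible `X` — symmetry not needed —, `c ≠ 0`).  ROAD READING (F-g8-3, `K-END-RECUT-SPEC.md` §8): with `A := fromBlocks (kkt (K+cDDᵀ) Q) 0 0 0`
# on `(ν ⊕ μ) ⊕ m`, `E := [−cD; 0; 0]`, `F := [0; 0; −Q′]`, `X := L_U + aQ′ᵀQ′ = G′_U⁻¹`, the right-hand Schur complement IS `ProjectorWeightUnfold`'s `η`-augmented matrix
# with `M = X⁻¹Q′ᵀ = G′_UQ′ᵀ`; so, with (U1) `ProjectorWeightUnfold.det_aug_eq_det_gram_mul_det_kkt`,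
#   `det 𝔅_U = (−1)^{|σ|}·det(X_U)²·det(c·Q′G′_U²Q′ᵀ)·det kkt (K + c·D_U·R_U·D_U*) Q`
# — the R-weighted N-side of (R1-L) is the FULLY LOCAL bordered system `𝔅_U` (every U-dependent block LINEAR in `K^L_U`, `D_U`, `X_U`, `Q_U`) divided by two massive
# covariant towers `det X_U` and the coarse Gram `det(c·Q′G′_U²Q′ᵀ)`; Hessian form `h_N^{cov} = h[𝔅_U] − 2h[X_U] − h[Q′G′_U²Q′ᵀ] = h[𝔅_U] − h_Ψ` (kit j119806, exact on random data)

HONEST DEPENDENCY (cell records, verbatim): «continuum YM on T⁴ ⇐ BetaPertH ∧ nine spine estimates (0/9 proved); BetaPertH ⇐ (D1) ∧ (D4) ∧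
CAP+tail; G-an2-4 gates asym, D1 and NE2/3/4.»  HONEST FRAMING (cell contract, verbatim): «discharging `BetaPertH` makes Bałaban's UV stability
UNCONDITIONAL — a real constructive-QFT result; it is NOT the continuum limit and NOT the Clay problem.»  THIS MODULE DISCHARGES NOTHING of (K),
of D1 or of the wall: [folklore] finite-dimensional linear algebra (Mathlib Schur-complement determinants).  No definition, no `def … : Prop`, nothing
cited, no wall binder instantiated, 0 sorry.  NOT D1, NOT BetaPertH, NOT continuum, NOT Clay.

ABSOLUTE RULE (cell charter, verbatim): «No internally-minted statement may enter as a cited fact. Every hypothesis is either kernel-proved in this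
package or a verbatim quotation of a PUBLISHED theorem with page reference. The manuscript(s) under audit are NOT citable for their own disputed
steps — they are the thing under adjudication; programme-internal (2001/route/tribunal) claims are never citable.»

CONTENT (field `𝕜`; `α` any finite index type; `σ` the auxiliary block; `A : α×α`, `E F : α×σ`, `X : σ×σ`, `c : 𝕜`):
* §1 [folklore] the auxiliary block `Zaux c X := fromBlocks (c•1) X X 0`: explicit inverse `fromBlocks 0 X⁻¹ X⁻¹ (−c•X⁻¹X⁻¹)` for invertible `X`
  (`zauxInv_mul`), `det (Zaux c X) = (−1)^{|σ|}·det(X)²` for `c ≠ 0` (`det_zaux`).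
* §2 [folklore] **`det_fromBlocks_zaux`**: the displayed identity.
Unit `b2b-balaban-beta-d1-p2` (road owner, gen 8); `K-END-RECUT-SPEC.md` §8 (d2-a).
-/

namespace Summit.QuantumFields.BalabanUV.Beta.D1BFx.ResolventWeightUnfold

open Matrix

section Field

variable {𝕜 : Type*} [Field 𝕜]
variable {α σ : Type*} [Fintype α] [Fintype σ] [DecidableEq α] [DecidableEq σ]

/-! ## §1 The auxiliary block and its inverse ∕ determinant -/

omit [Fintype α] [DecidableEq α] in
/-- [folklore] **LEFT INVERSE OF THE AUXILIARY BLOCK**: for `X` with `det X` a unit,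
`fromBlocks 0 X⁻¹ X⁻¹ (−c•(X⁻¹X⁻¹)) * fromBlocks (c•1) X X 0 = 1`. -/
theorem zauxInv_mul (c : 𝕜) {X : Matrix σ σ 𝕜} (hXu : IsUnit X.det) :
    fromBlocks (0 : Matrix σ σ 𝕜) X⁻¹ X⁻¹ (-(c • (X⁻¹ * X⁻¹))) * fromBlocks (c • (1 : Matrix σ σ 𝕜)) X X 0 = 1 := by
  rw [fromBlocks_multiply]
  have h1 : X⁻¹ * X = 1 := nonsing_inv_mul _ hXu
  rw [← fromBlocks_one]
  congr 1
  · rw [Matrix.zero_mul, zero_add, h1]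
  · rw [Matrix.zero_mul, Matrix.mul_zero, add_zero]
  · rw [Matrix.mul_smul, Matrix.mul_one, Matrix.neg_mul, Matrix.smul_mul, Matrix.mul_assoc, h1, Matrix.mul_one, add_neg_cancel]
  · rw [h1, Matrix.mul_zero, add_zero]

omit [Fintype α] [DecidableEq α] in
/-- [folklore] `det (fromBlocks (c•1) X X 0)` is a unit (it has a left inverse). -/
theorem isUnit_det_zaux (c : 𝕜) {X : Matrix σ σ 𝕜} (hXu : IsUnit X.det) :
    IsUnit (fromBlocks (c • (1 : Matrix σ σ 𝕜)) X X 0).det :=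
  isUnit_det_of_left_inverse (zauxInv_mul c hXu)

omit [Fintype α] [DecidableEq α] in
/-- [folklore] The inverse of the auxiliary block, as a matrix equation. -/
theorem zaux_inv (c : 𝕜) {X : Matrix σ σ 𝕜} (hXu : IsUnit X.det) :
    (fromBlocks (c • (1 : Matrix σ σ 𝕜)) X X 0)⁻¹ = fromBlocks (0 : Matrix σ σ 𝕜) X⁻¹ X⁻¹ (-(c • (X⁻¹ * X⁻¹))) :=
  inv_eq_left_inv (zauxInv_mul c hXu)

omit [Fintype α] [DecidableEq α] in
/-- [folklore] **`det (fromBlocks (c•1) X X 0) = (−1)^{|σ|}·det(X)²`** for `c ≠ 0` (Schur complement of the `c•1` block). -/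
theorem det_zaux {c : 𝕜} (hc : c ≠ 0) (X : Matrix σ σ 𝕜) :
    (fromBlocks (c • (1 : Matrix σ σ 𝕜)) X X 0).det = (-1) ^ Fintype.card σ * X.det ^ 2 := by
  have hcu : IsUnit (c • (1 : Matrix σ σ 𝕜)).det := by
    rw [det_smul, det_one, mul_one]; exact (isUnit_iff_ne_zero.mpr hc).pow _
  letI : Invertible (c • (1 : Matrix σ σ 𝕜)) := invertibleOfIsUnitDet _ hcu
  have hinv : (c • (1 : Matrix σ σ 𝕜))⁻¹ = c⁻¹ • (1 : Matrix σ σ 𝕜) := by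
    apply inv_eq_left_inv
    rw [Matrix.smul_mul, Matrix.mul_smul, Matrix.one_mul, smul_smul, inv_mul_cancel₀ hc, one_smul]
  rw [det_fromBlocks₁₁, invOf_eq_nonsing_inv, hinv, det_smul, det_one, mul_one, Matrix.mul_smul, Matrix.smul_mul, Matrix.mul_one,
    zero_sub, det_neg, det_smul, det_mul, Fintype.card]
  rw [Finset.card_univ]
  have hcc : c ^ Fintype.card σ * c⁻¹ ^ Fintype.card σ = 1 := by
    rw [← mul_pow, mul_inv_cancel₀ hc, one_pow]
  linear_combination ((-1 : 𝕜) ^ Fintype.card σ * (X.det * X.det)) * hcc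

/-! ## §2 The second un-folding -/

/-- [folklore] **RESOLVENT UN-FOLDING (determinant form)**: for any square `A`, couplings `E F : α × σ`, any `X` with `det X` a unit (symmetry NOT needed) and `c ≠ 0`,
`det (fromBlocks A (fromCols E F) (fromRows Eᵀ Fᵀ) (fromBlocks (c•1) X X 0)) = (−1)^{|σ|}·det(X)²·det (A − F·X⁻¹·Eᵀ − E·X⁻¹·Fᵀ + c•(F·X⁻¹·X⁻¹·Fᵀ))`
— the resolvent `X⁻¹` appears ONLY in the Schur complement; the big matrix is LINEAR in `X`. -/
theorem det_fromBlocks_zaux (A : Matrix α α 𝕜) (E F : Matrix α σ 𝕜) {X : Matrix σ σ 𝕜} (hXu : IsUnit X.det)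
    {c : 𝕜} (hc : c ≠ 0) :
    (fromBlocks A (fromCols E F) (fromRows Eᵀ Fᵀ) (fromBlocks (c • (1 : Matrix σ σ 𝕜)) X X 0)).det
      = (-1) ^ Fintype.card σ * X.det ^ 2 * (A - F * X⁻¹ * Eᵀ - E * X⁻¹ * Fᵀ + c • (F * X⁻¹ * X⁻¹ * Fᵀ)).det := by
  letI : Invertible (fromBlocks (c • (1 : Matrix σ σ 𝕜)) X X 0) := invertibleOfIsUnitDet _ (isUnit_det_zaux c hXu)
  rw [det_fromBlocks₂₂, invOf_eq_nonsing_inv, zaux_inv c hXu, det_zaux hc X]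
  congr 1
  rw [fromCols_mul_fromBlocks, fromCols_mul_fromRows]
  simp only [Matrix.mul_zero, zero_add, Matrix.mul_neg, Matrix.mul_smul, Matrix.add_mul, Matrix.neg_mul, Matrix.smul_mul]
  simp only [Matrix.mul_assoc]
  abel

end Field

end Summit.QuantumFields.BalabanUV.Beta.D1BFx.ResolventWeightUnfold
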